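import Summits.CriticalPhenomena.PercolationContinuityZ3.Theorems.Transplant.AutChartOrbitsOneLampAutSigns
import HarnessLib

/-!
# Label-preserving actions on a one-lamp frame, IV: the TRANSPORT of lamps `Θ_α` — `α·(m·δ) = Θ_α(m)·(α·δ)` with `Θ_α` multiplicative on `L` and
# `Θ_α(h s h⁻¹) = ((T h) s (T h)⁻¹)^{sgn α h}` (every acting element is 'translation ∘ signed relabelling of positions ∘ tree part')

builds on p205010 (kernel theorem, internal audit signed; external expert review pending) — nothing in this file uses p205010; pure group theory, no
percolation statement, nothing about any `@[conjecture]`.  Lane `prim-bschramm`, seat `prim-bschramm-p3` gen 36 (DESIGN OWNER; `P3-NILPOTENT.md` §29.2–29.4,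
the structure theorem behind located item L-p5g31-3).  Helper file (`--supports stmt-CriticalPhenomena-4575 --as helper`).

CONTENT (`F : OneLampFrame Γ`, `A : F.LabelAction 𝒜`, «AutChartOrbitsOneLampAutDefs» p599738 / «…AutSigns» p600197): the def `transport A α m :=
lam(α·m) · lam(α·1)⁻¹` and
* `smul_mul_eq_transport_mul` — THE STRUCTURE FORMULA `α·(m·δ) = Θ_α(m)·(α·δ)` for every lamp `m ∈ L` and every vertex `δ` (closure induction from the left rule);
* `transport_mul`, `transport_inv`, `transport_one`, `transport_mem` — `Θ_α` is a multiplicative self-map of `L`;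
* `transport_conj` — on a position: `Θ_α(h s h⁻¹) = ((T h) s (T h)⁻¹)^{sgn α h}`, `T = treePart α`;
* `transport_eq_of_commute` — if `α` commutes (as a map) with the pure translation by `m`, then `Θ_α(m) = m`.
So an acting element is determined by `lam(α·1)`, its sign pattern and its tree part: the abstract form of 'Aut = Γ extended by the position-wise lamp
reflections' (`P3-NILPOTENT` §29.2).
[cite: BenjaminiSchramm1996, Conj. 4; §2] [cite: BartholdiErschler2012, §2 (permutational wreath products)]
-/

namespace Summit.CriticalPhenomena.PercolationContinuityZ3.Theorems.Transplant

namespace OneLampFrame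

namespace LabelAction

variable {Γ : Type} [Group Γ] {F : OneLampFrame Γ} {𝒜 : Type} [Group 𝒜] [MulAction 𝒜 Γ]

/-- **The transport of lamps** under an acting element: `Θ_α(m) := lam(α·m) · lam(α·1)⁻¹`. [folklore] -/
noncomputable def transport (_A : F.LabelAction 𝒜) (α : 𝒜) (m : Γ) : Γ := F.lam (α • m) * (F.lam (α • (1 : Γ)))⁻¹

variable (A : F.LabelAction 𝒜)
include A

/-- `Θ_α(m) ∈ L`. [folklore] -/
theorem transport_mem (α : 𝒜) (m : Γ) : A.transport α m ∈ F.L :=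
  F.L.mul_mem (F.lam_mem _) (F.L.inv_mem (F.lam_mem _))

/-- `Θ_α(1) = 1`. [folklore] -/
theorem transport_one (α : 𝒜) : A.transport α 1 = 1 := by
  unfold transport; rw [mul_inv_cancel]

/-- **THE STRUCTURE FORMULA**: `α·(m·δ) = Θ_α(m)·(α·δ)` for every `m ∈ L` and every `δ`; together with multiplicativity of `Θ_α`
(closure induction from the left rule «…AutSigns» `smul_conj_zpow_mul`). [folklore] -/
theorem smul_mul_and_transport_mul (α : 𝒜) :
    (∀ m ∈ F.L, ∀ δ : Γ, α • (m * δ) = A.transport α m * (α • δ)) ∧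
      (∀ m₁ ∈ F.L, ∀ m₂ ∈ F.L, A.transport α (m₁ * m₂) = A.transport α m₁ * A.transport α m₂) := by
  -- the formula with SOME lamp in front determines that lamp as `Θ_α(m)` (evaluate at `δ = 1`)
  have determine : ∀ m ∈ F.L, ∀ t ∈ F.L, (∀ δ : Γ, α • (m * δ) = t * (α • δ)) → t = A.transport α m := by
    intro m hm t ht h
    have h1 := h 1
    rw [mul_one] at h1
    unfold transport
    rw [h1, (F.lam_tr_mul_of_mem_L ht _).1, mul_inv_cancel_right]
  -- closure induction: existence of a front lamp for every `m` in the closure of the positions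
  have key : ∀ m ∈ Subgroup.closure {y : Γ | ∃ h ∈ F.H, y = h * F.s * h⁻¹}, ∃ t ∈ F.L, ∀ δ : Γ, α • (m * δ) = t * (α • δ) := by
    intro m hm
    refine Subgroup.closure_induction (p := fun m _ => ∃ t ∈ F.L, ∀ δ : Γ, α • (m * δ) = t * (α • δ)) ?_ ?_ ?_ ?_ hm
    · rintro y ⟨h, hh, rfl⟩
      refine ⟨(A.treePart α * h * F.s * (A.treePart α * h)⁻¹) ^ (A.sgn α h * 1), F.L.zpow_mem (F.conj_mem_L F.s_mem _) _, fun δ => ?_⟩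
      have := A.smul_conj_zpow_mul α hh δ 1
      rwa [zpow_one] at this
    · exact ⟨1, F.L.one_mem, fun δ => by rw [one_mul, one_mul]⟩
    · rintro x y - - ⟨t₁, ht₁, hx⟩ ⟨t₂, ht₂, hy⟩
      exact ⟨t₁ * t₂, F.L.mul_mem ht₁ ht₂, fun δ => by rw [mul_assoc, hx, hy, mul_assoc]⟩
    · rintro x - ⟨t, ht, hx⟩
      refine ⟨t⁻¹, F.L.inv_mem ht, fun δ => ?_⟩
      have h := hx (x⁻¹ * δ)
      rw [mul_inv_cancel_left] at h
      rw [h, inv_mul_cancel_left]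
  have formula : ∀ m ∈ F.L, ∀ δ : Γ, α • (m * δ) = A.transport α m * (α • δ) := by
    intro m hm δ
    obtain ⟨t, ht, h⟩ := key m (F.gen m hm)
    rw [← determine m hm t ht h]; exact h δ
  refine ⟨formula, fun m₁ hm₁ m₂ hm₂ => ?_⟩
  symm
  refine determine (m₁ * m₂) (F.L.mul_mem hm₁ hm₂) _ (F.L.mul_mem (A.transport_mem α m₁) (A.transport_mem α m₂)) fun δ => ?_
  rw [mul_assoc, formula m₁ hm₁, formula m₂ hm₂, mul_assoc]

/-- `α·(m·δ) = Θ_α(m)·(α·δ)`. [folklore] -/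
theorem smul_mul_eq_transport_mul (α : 𝒜) {m : Γ} (hm : m ∈ F.L) (δ : Γ) : α • (m * δ) = A.transport α m * (α • δ) :=
  (A.smul_mul_and_transport_mul α).1 m hm δ

/-- `Θ_α` is multiplicative on `L`. [folklore] -/
theorem transport_mul (α : 𝒜) {m₁ m₂ : Γ} (hm₁ : m₁ ∈ F.L) (hm₂ : m₂ ∈ F.L) :
    A.transport α (m₁ * m₂) = A.transport α m₁ * A.transport α m₂ :=
  (A.smul_mul_and_transport_mul α).2 m₁ hm₁ m₂ hm₂

/-- `Θ_α(m⁻¹) = Θ_α(m)⁻¹`. [folklore] -/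
theorem transport_inv (α : 𝒜) {m : Γ} (hm : m ∈ F.L) : A.transport α m⁻¹ = (A.transport α m)⁻¹ := by
  have h := A.transport_mul α hm (F.L.inv_mem hm)
  rw [mul_inv_cancel, A.transport_one] at h
  exact (eq_inv_of_mul_eq_one_right h.symm)

/-- `Θ_α(m^k) = Θ_α(m)^k`. [folklore] -/
theorem transport_zpow (α : 𝒜) {m : Γ} (hm : m ∈ F.L) (k : ℤ) : A.transport α (m ^ k) = A.transport α m ^ k := by
  induction k using Int.induction_on with
  | zero => rw [zpow_zero, zpow_zero, A.transport_one]
  | succ k ih => rw [zpow_add_one, A.transport_mul α (F.L.zpow_mem hm k) hm, ih, zpow_add_one]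
  | pred k ih => rw [zpow_sub_one, A.transport_mul α (F.L.zpow_mem hm _) (F.L.inv_mem hm), ih, A.transport_inv α hm, zpow_sub_one]

/-- **`Θ_α` on a position**: `Θ_α(h s h⁻¹) = ((T h) s (T h)⁻¹)^{sgn α h}`. [folklore] -/
theorem transport_conj (α : 𝒜) {h : Γ} (hh : h ∈ F.H) :
    A.transport α (h * F.s * h⁻¹) = (A.treePart α * h * F.s * (A.treePart α * h)⁻¹) ^ A.sgn α h := by
  have h1 := A.smul_mul_eq_transport_mul α (F.conj_mem_L F.s_mem h) 1
  have h2 := A.smul_conj_zpow_mul α hh 1 1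
  simp only [zpow_one, mul_one] at h1 h2
  rw [h2] at h1
  exact (mul_right_cancel h1).symm

/-- **Commuting with a pure translation pins the transport**: if `α·(m·δ) = m·(α·δ)` for all `δ` then `Θ_α(m) = m`. [folklore] -/
theorem transport_eq_of_commute (α : 𝒜) {m : Γ} (hm : m ∈ F.L) (h : ∀ δ : Γ, α • (m * δ) = m * (α • δ)) : A.transport α m = m := by
  have h1 := A.smul_mul_eq_transport_mul α hm 1
  rw [h 1] at h1
  exact (mul_right_cancel h1).symm

end LabelAction

end OneLampFrame

end Summit.CriticalPhenomena.PercolationContinuityZ3.Theorems.Transplant
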